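import Summits.ValiantsHypothesis.ValiantsHypothesis.Theses.SOSTau

/-!
# Census sketch, generation 2 (crux-strategist r1, second opinion) — crux `SOSTau`

Typed statements quoted in `STRATEGY-CENSUS.md` (Gen 2 additions). Cheap directions are proved;
nothing here is a line (no `SOSTau_of`). Namespace `…Cruxes.SOSTau.Census3`.
-/

set_option linter.dupNamespace false

namespace Summit.ValiantsHypothesis.ValiantsHypothesis.Cruxes.SOSTau.Census3

open Polynomial Finset
open Summit.ValiantsHypothesis.ValiantsHypothesis.Theses.SOSTau (SOSTau)

/-- The represented polynomial `F = Σ a_i g_i²`. -/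
noncomputable def sosF {s : ℕ} (a : Fin s → ℝ) (g : Fin s → ℝ[X]) : ℝ[X] :=
  ∑ i, C (a i) * g i ^ 2

/-- The support-sum `S = Σ |supp g_i|`. -/
def suppSum {s : ℕ} (g : Fin s → ℝ[X]) : ℕ := ∑ i, (g i).support.card

/-- Decomposition D6 — the three-square case (printed OPEN: Dutta 2021 §8 Q2 "currently we only know it
for s = 2"; contains Chattopadhyay's `fg + 1`). Strictly weaker than the crux, famous, but it does NOT feed
the route's `closes` (the magnification needs s → ∞). -/
def SOSTauThree : Prop :=
  ∃ c : ℕ, ∀ (a : Fin 3 → ℝ) (g : Fin 3 → ℝ[X]), (sosF a g).roots.toFinset.card ≤ c * suppSum g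

theorem sosTauThree_of_crux (h : SOSTau) : SOSTauThree := by
  obtain ⟨c, hc⟩ := h
  exact ⟨c, fun a g => hc 3 a g⟩

/-- Decomposition D5 — count only CROSSING zeros (odd multiplicity). The converse reduction
`CrossingSOSTau → SOSTau` (with c ↦ 4c) is elementary real analysis (perturb by `± ε`, one extra
square of support 1), so this "piece" is the crux up to a constant: a bridge split through it is not honest. -/
def CrossingSOSTau : Prop :=
  ∃ c : ℕ, ∀ (s : ℕ) (a : Fin s → ℝ) (g : Fin s → ℝ[X]),
    ((sosF a g).roots.toFinset.filter (fun x => Odd ((sosF a g).rootMultiplicity x))).card ≤ c * suppSum g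

theorem crossing_of_crux (h : SOSTau) : CrossingSOSTau := by
  obtain ⟨c, hc⟩ := h
  exact ⟨c, fun s a g => le_trans (Finset.card_filter_le _ _) (hc s a g)⟩

/-- Positive and negative parts of a weighted SOS: `F = posPart − negPart`, both sums of squares with
nonnegative weights. -/
noncomputable def posPart {s : ℕ} (a : Fin s → ℝ) (g : Fin s → ℝ[X]) : ℝ[X] :=
  ∑ i, C (max (a i) 0) * g i ^ 2

noncomputable def negPart {s : ℕ} (a : Fin s → ℝ) (g : Fin s → ℝ[X]) : ℝ[X] :=
  ∑ i, C (max (-(a i)) 0) * g i ^ 2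

theorem sosF_eq_posPart_sub_negPart {s : ℕ} (a : Fin s → ℝ) (g : Fin s → ℝ[X]) :
    sosF a g = posPart a g - negPart a g := by
  unfold sosF posPart negPart
  rw [← Finset.sum_sub_distrib]
  refine Finset.sum_congr rfl fun i _ => ?_
  rw [← sub_mul, ← C_sub]
  congr 2
  rcases le_total (a i) 0 with h | h
  · rw [max_eq_right h, max_eq_left (by linarith)]; ring
  · rw [max_eq_left h, max_eq_right (by linarith)]; ring

/-- Strengthen S7 — LAP COUNT: the Wronskian `W(P, N) = P′N − PN′` of the positive and negative parts has
linearly many distinct real zeros. Implies the crux by Rolle for `P/N` (paper: between consecutive zeros of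
`F = P − N` not separated by a zero of `N` lies a zero of `(P/N)′ = W/N²`; zeros of `N` are ≤ 2·S). It is
STRICTLY HARDER already at s = 2, where `W = g₁ g₂ (g₁′g₂ − g₁g₂′)·|a₁a₂|` and the zero count of the sparse
Wronskian `g₁′g₂ − g₁g₂′` (|supp| ≤ T₁T₂) is not known to be linear, while the crux at s = 2 is Dutta's Thm 9. -/
def LapCountSOS : Prop :=
  ∃ c : ℕ, ∀ (s : ℕ) (a : Fin s → ℝ) (g : Fin s → ℝ[X]),
    (derivative (posPart a g) * negPart a g - posPart a g * derivative (negPart a g)).roots.toFinset.card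
      ≤ c * suppSum g

/-- Transfer T9 bookkeeping: the fewnomial-system encoding. A real zero `x > 0` of `F` gives a positive
solution `(x, z)` with `z_i = g_i x` of the system `z_i − g_i(x) = 0 (i < s)`, `Σ a_i z_i² = 0`, which has
`s + 1` variables and at most `suppSum g + 2 s` distinct monomials — Khovanskii/Bihan–Sottile bound the number
of non-degenerate positive solutions by `2^{O(k²)} (s+1)^k` with `k = #monomials − #variables − 1 ≈ S + s`,
exponential in exactly the parameter that must enter linearly. Recorded as the monomial count only. -/
theorem fewnomial_monomial_budget {s : ℕ} (g : Fin s → ℝ[X]) :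
    suppSum g + 2 * s - (s + 1) - 1 = suppSum g + s - 2 := by
  unfold suppSum; omega

end Summit.ValiantsHypothesis.ValiantsHypothesis.Cruxes.SOSTau.Census3
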